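import Literature.AlgebraicGeometry.Modules.EquivariantStructureRestrictOfPullback
import Literature.AlgebraicGeometry.RelativeSpec.EquivariantModuleInvariants
import Literature.AlgebraicGeometry.Modules.DualSectionsEquiv
import HarnessLib

/-!
# The canonical linearisation and the second coface of a square; intertwiners transport the action on sections

Layer `Literature/AlgebraicGeometry/RelativeSpec`, namespaces `Literature.AlgebraicGeometry.RelativeSpec.ActionOver` (§1) and
`Literature.AlgebraicGeometry.RelativeSpec` (§2).  THEOREMS ONLY (no definition, no named fact, no instance, no notation, no `sorry`);
generic bookkeeping for Mathlib's inverse-image pseudofunctor `Scheme.Modules.pullback`, sequel to ★ `Modules/EquivariantStructure`,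
★ `Modules/EquivariantStructureRestrict(OfPullback)` (`squareIso`, `ofPullback_iso_hom_app_unitSection`) and ★
`RelativeSpec/EquivariantModuleInvariants` (`actSections`).  Cell `hodgecm-mathlib` (D-0151), FLOOR 0, P6 «MOD programme» (crux hLiu418 =
stmt-HodgeConjecture-24832), W-line `stub_W1` «WeilPairingNatural», σ1 road organ (σ1-d2) «coface computation» (consumer:
`AbelianSchemes/WeilUnitNondegeneracy`, which feeds ★ `WeilUnitNondegeneracyOfCofaces.eq_one_of_cofaces_agree`).  HC_CM is proved only modulo the
printed citations until rung 0 closes; nothing here is about HC.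

THE PRINT.  [MumfordAV1970] §7 Prop. 2 (p. 70) / [MumfordFogartyKirwan1994] Ch. 1 §3 Def. 1.6: a module pulled back from the quotient carries the CANONICAL
`G`-linearisation `σ_g^* p^* F ≅ (σ_g ≫ p)^* F = p^* F`; for the kernel pair `Z ⇉ X` of a `G`-torsor `X → Q` («`X ×_Q X ≅ G × X`», [MumfordAV1970] §12
Thm. 1 (p. 112), proof; [SGA1] VIII 1.1 for the descent reading) the second coface of a section IS the action of `g` on its first coface.  This file is
that sentence for Mathlib's abstract `pullbackComp` / `pullbackCongr` isomorphisms.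

* §1 `ActionOver.actSections_app_of_intertwine` — a morphism `θ : E → E′` intertwining would-be structure isomorphisms `φ_g`, `φ′_g` transports the
  actions on sections: `θ (g · s) = g · θ(s)`; `actSections_eq_self_of_iso` — hence «every section is invariant» passes along an intertwining
  isomorphism; `iso_hom_app_unitSection_of_actSections_eq_self` — an invariant section read before the transport `σ_g⁻¹ p⁻¹ V = p⁻¹ V` (the
  naturality of ★ `EquivariantStructure.ofPullback ρ F` in `F` is ★ `PullbackIsoDiscrepancy.ofPullback_iso_hom_naturality`).
* §2 **`squareIso_coface_coherence`** — for a commuting square `q ≫ r = p ≫ q₂` (`q : Z → X`, `r : X → Y`, `p : Z → Z′`, `q₂ : Z′ → Y`), an action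
  `ρ` on `Z` over `p`, `g ∈ G` and ANY equation `H : (σ_g ≫ q) ≫ r = q ≫ r`, the two morphisms `(σ_g ≫ q)^* r^* L ⟶ p^* q₂^* L`
  «`(σ_g ≫ q)^* r^* ≅ σ_g^* q^* r^* ≅ σ_g^* p^* q₂^*` then the canonical structure isomorphism of `p^*(q₂^* L)` at `g`» and
  «`(σ_g ≫ q)^* r^* ≅ ((σ_g ≫ q) ≫ r)^* = (q ≫ r)^* ≅ q^* r^* ≅ p^* q₂^*`» AGREE (checked on the pulled-back sections `η(η(m))`, ★
  `pullback_pullback_hom_ext_unitSection`, where both are `η_p(η_{q₂}(m))` transported).  Read on a section `s` of `r^* L`: the SECOND COFACE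
  `(σ_g ≫ q)^* s`, moved to `p^* q₂^* L`, is `φ_g(σ_g^*(\text{first coface}))`, i.e. the action of `g` on the first coface `q^* s`;
  element form **`coface_eq_of_actSections_eq_self`** — if `g` fixes the first coface of a global section `s` (read in `p^* q₂^* L`), the two
  cofaces of `s` read in `(q ≫ r)^* L` agree (the `hcof` shape of ★ `TrivialisationFpqcDescent.nonempty_iso_unit_of_cofaceFst_eq_cofaceSnd`).

## References
* [MumfordAV1970] D. Mumford, *Abelian Varieties* (1970), §7 Prop. 2 (p. 70), §12 Thm. 1 (p. 112).
* [MumfordFogartyKirwan1994] D. Mumford, J. Fogarty, F. Kirwan, *Geometric Invariant Theory*, 3rd ed. (1994), Ch. 1 §3 Def. 1.6 (p. 30).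
* [Hartshorne1977] R. Hartshorne, *Algebraic Geometry* (1977), II.5 (p. 110).
-/

set_option autoImplicit false

noncomputable section

-- `TopCat.Presheaf`/`Scheme.Modules` are not reducible (as in Mathlib's `AlgebraicGeometry/Modules`).
set_option backward.isDefEq.respectTransparency false

universe u

open CategoryTheory Limits AlgebraicGeometry TopologicalSpace Opposite

namespace Literature.AlgebraicGeometry.RelativeSpec

open Literature.AlgebraicGeometry.Modules Literature.AlgebraicGeometry.HodgeTheory Literature.AlgebraicGeometry.Motives

/-! ## §1 Intertwiners transport the action on sections -/

namespace ActionOver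

variable {X Q : Scheme.{u}} {p : X ⟶ Q} {G : Type u} [Group G] (ρ : ActionOver p G)

/-- **An intertwiner transports the action on sections**: if `θ : E ⟶ E′` satisfies `φ_g ≫ θ = σ_g^* θ ≫ φ′_g`, then
`θ(g · s) = g · θ(s)` for the actions on sections ★ `actSections` defined by `φ`, `φ′`. [cite: MumfordFogartyKirwan1994, Ch. 1 §3 Def. 1.6 (p. 30)] -/
theorem actSections_app_of_intertwine {E E' : X.Modules}
    (φ : ∀ g : G, (Scheme.Modules.pullback (ρ.aut g).hom).obj E ≅ E)
    (φ' : ∀ g : G, (Scheme.Modules.pullback (ρ.aut g).hom).obj E' ≅ E') (θ : E ⟶ E') (g : G)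
    (hθ : (φ g).hom ≫ θ = (Scheme.Modules.pullback (ρ.aut g).hom).map θ ≫ (φ' g).hom)
    (V : Q.Opens) (s : Γ(E, p ⁻¹ᵁ V)) :
    θ.app (p ⁻¹ᵁ V) (ρ.actSections E φ g V s) = ρ.actSections E' φ' g V (θ.app (p ⁻¹ᵁ V) s) := by
  have h := congrArg (fun ψ => Scheme.Modules.Hom.app ψ ((ρ.aut g).hom ⁻¹ᵁ (p ⁻¹ᵁ V))
    (unitSection (ρ.aut g).hom E (p ⁻¹ᵁ V) s)) hθ
  simp only [Scheme.Modules.Hom.comp_app, CategoryTheory.comp_apply] at h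
  rw [pullback_map_app_unitSection (ρ.aut g).hom θ (p ⁻¹ᵁ V) s] at h
  rw [actSections_eq, actSections_eq, app_presheaf_map, h]

/-- **Invariance passes along an intertwining isomorphism**: if every section of `E` over `p⁻¹V` is fixed by `g` and `θ : E ≅ E′`
intertwines `φ_g`, `φ′_g`, then every section of `E′` over `p⁻¹V` is fixed by `g`. [cite: MumfordFogartyKirwan1994, Ch. 1 §3 Def. 1.6 (p. 30)] -/
theorem actSections_eq_self_of_iso {E E' : X.Modules}
    (φ : ∀ g : G, (Scheme.Modules.pullback (ρ.aut g).hom).obj E ≅ E)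
    (φ' : ∀ g : G, (Scheme.Modules.pullback (ρ.aut g).hom).obj E' ≅ E') (θ : E ≅ E') (g : G)
    (hθ : (φ g).hom ≫ θ.hom = (Scheme.Modules.pullback (ρ.aut g).hom).map θ.hom ≫ (φ' g).hom)
    (V : Q.Opens) (h : ∀ s : Γ(E, p ⁻¹ᵁ V), ρ.actSections E φ g V s = s) (s' : Γ(E', p ⁻¹ᵁ V)) :
    ρ.actSections E' φ' g V s' = s' := by
  have hs' : θ.hom.app (p ⁻¹ᵁ V) (θ.inv.app (p ⁻¹ᵁ V) s') = s' := by
    rw [← CategoryTheory.comp_apply, ← Scheme.Modules.Hom.comp_app, Iso.inv_hom_id, Scheme.Modules.Hom.id_app]; rfl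
  rw [← hs', ← actSections_app_of_intertwine ρ φ φ' θ.hom g hθ V, h]

/-- **An invariant section, read before the transport**: if `g · s = s` then `φ_g(η_{σ_g}(s))` is `s` moved along `σ_g⁻¹ p⁻¹ V = p⁻¹ V`
(★ `actSections_eq` unfolded). [cite: MumfordFogartyKirwan1994, Ch. 1 §3 Def. 1.6 (p. 30)] -/
theorem iso_hom_app_unitSection_of_actSections_eq_self {E : X.Modules}
    (φ : ∀ g : G, (Scheme.Modules.pullback (ρ.aut g).hom).obj E ≅ E) (g : G) (V : Q.Opens) (s : Γ(E, p ⁻¹ᵁ V))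
    (h : ρ.actSections E φ g V s = s) :
    (φ g).hom.app ((ρ.aut g).hom ⁻¹ᵁ (p ⁻¹ᵁ V)) (unitSection (ρ.aut g).hom E (p ⁻¹ᵁ V) s) =
      E.presheaf.map (eqToHom (ρ.preimage_preimage g V)).op s := by
  rw [actSections_eq] at h
  have h' := congrArg (E.presheaf.map (eqToHom (ρ.preimage_preimage g V)).op) h
  rw [presheaf_map_map_congr _ _ _ (𝟙 _), presheaf_map_self] at h'
  exact h'

end ActionOver

/-! ## §2 The second coface of a square is the action on the first coface -/

section Square

variable {X Y Z Z' : Scheme.{u}} (r : X ⟶ Y) (q : Z ⟶ X) {p : Z ⟶ Z'} (q₂ : Z' ⟶ Y) (hsq : q ≫ r = p ≫ q₂)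
  {G : Type u} [Group G] (ρ : ActionOver p G) (g : G) (L : Y.Modules)

/-- **THE SECOND COFACE IS THE ACTION ON THE FIRST COFACE** (morphism form, for a commuting square `q ≫ r = p ≫ q₂` with an action `ρ` on `Z` over
`p` and any `H : (σ_g ≫ q) ≫ r = q ≫ r`): the composites `(σ_g ≫ q)^* r^* L ≅ σ_g^* q^* r^* L ≅ σ_g^* p^* q₂^* L → p^* q₂^* L` (last arrow: the
canonical structure isomorphism ★ `ofPullback ρ (q₂^* L)` at `g`) and `(σ_g ≫ q)^* r^* L ≅ ((σ_g ≫ q) ≫ r)^* L = (q ≫ r)^* L ≅ q^* r^* L ≅ p^* q₂^* L`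
are EQUAL — both send `η(η(m))` to (a transport of) `η_p(η_{q₂}(m))`. [cite: MumfordAV1970, §7 Prop. 2 (p. 70)] [cite: MumfordAV1970, §12 Thm. 1 (p. 112)]
[cite: Hartshorne1977, II.5 (p. 110)] -/
theorem squareIso_coface_coherence (H : (ρ.autHom g ≫ q) ≫ r = q ≫ r) :
    (Scheme.Modules.pullbackComp (ρ.autHom g) q).inv.app ((Scheme.Modules.pullback r).obj L) ≫
        (Scheme.Modules.pullback (ρ.autHom g)).map (squareIso hsq L).hom ≫
          ((ActionOver.EquivariantStructure.ofPullback ρ ((Scheme.Modules.pullback q₂).obj L)).iso g).hom =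
      (Scheme.Modules.pullbackComp (ρ.autHom g ≫ q) r).hom.app L ≫ (Scheme.Modules.pullbackCongr H).hom.app L ≫
        (Scheme.Modules.pullbackComp q r).inv.app L ≫ (squareIso hsq L).hom := by
  refine pullback_pullback_hom_ext_unitSection (ρ.autHom g ≫ q) r _ _ fun V m => ?_
  have e₁ : q ⁻¹ᵁ (r ⁻¹ᵁ V) = p ⁻¹ᵁ (q₂ ⁻¹ᵁ V) := by
    rw [← Scheme.Hom.comp_preimage, ← Scheme.Hom.comp_preimage, hsq]
  have e₂ : ((ρ.autHom g ≫ q) ≫ r) ⁻¹ᵁ V = (q ≫ r) ⁻¹ᵁ V := by rw [H]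
  have hk : ρ.autHom g ⁻¹ᵁ (q ⁻¹ᵁ (r ⁻¹ᵁ V)) = p ⁻¹ᵁ (q₂ ⁻¹ᵁ V) := by
    rw [e₁]; exact ρ.preimage_preimage g (q₂ ⁻¹ᵁ V)
  -- unit-section formulas for the six structural maps
  have a1 := pullbackComp_inv_app_unitSection' (ρ.autHom g) q ((Scheme.Modules.pullback r).obj L) (r ⁻¹ᵁ V)
    (unitSection r L V m)
  have a2 := pullback_map_app_unitSection (ρ.autHom g) (squareIso hsq L).hom (q ⁻¹ᵁ (r ⁻¹ᵁ V))
    (unitSection q ((Scheme.Modules.pullback r).obj L) (r ⁻¹ᵁ V) (unitSection r L V m))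
  have a3 := squareIso_hom_app_unitSection hsq L V m
  have a3' : (squareIso hsq L).hom.app ((q ≫ r) ⁻¹ᵁ V)
      (unitSection q ((Scheme.Modules.pullback r).obj L) (r ⁻¹ᵁ V) (unitSection r L V m)) =
      ((Scheme.Modules.pullback p).obj ((Scheme.Modules.pullback q₂).obj L)).presheaf.map (eqToHom e₁).op
        (unitSection p ((Scheme.Modules.pullback q₂).obj L) (q₂ ⁻¹ᵁ V) (unitSection q₂ L V m)) := a3
  have a5 := ofPullback_iso_hom_app_unitSection ρ ((Scheme.Modules.pullback q₂).obj L) g (q₂ ⁻¹ᵁ V) (unitSection q₂ L V m)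
  have b1 := pullbackComp_hom_app_unitSection (ρ.autHom g ≫ q) r L V m
  have b2 := pullbackCongr_hom_app_unitSection L H V m
  have b3 := pullbackComp_inv_app_unitSection' q r L V m
  -- respell the opens `(σ_g ≫ q)⁻¹ r⁻¹ V = σ_g⁻¹ q⁻¹ r⁻¹ V = ((σ_g ≫ q) ≫ r)⁻¹ V` (definitional) so that the formulas apply verbatim
  simp only [Scheme.Modules.Hom.comp_app, CategoryTheory.comp_apply]
  change ((ActionOver.EquivariantStructure.ofPullback ρ ((Scheme.Modules.pullback q₂).obj L)).iso g).hom.app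
      (ρ.autHom g ⁻¹ᵁ (q ⁻¹ᵁ (r ⁻¹ᵁ V)))
      (((Scheme.Modules.pullback (ρ.autHom g)).map (squareIso hsq L).hom).app (ρ.autHom g ⁻¹ᵁ (q ⁻¹ᵁ (r ⁻¹ᵁ V)))
        (((Scheme.Modules.pullbackComp (ρ.autHom g) q).inv.app ((Scheme.Modules.pullback r).obj L)).app
          ((ρ.autHom g ≫ q) ⁻¹ᵁ (r ⁻¹ᵁ V))
          (unitSection (ρ.autHom g ≫ q) ((Scheme.Modules.pullback r).obj L) (r ⁻¹ᵁ V) (unitSection r L V m)))) =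
    (squareIso hsq L).hom.app (((ρ.autHom g ≫ q) ≫ r) ⁻¹ᵁ V)
      (((Scheme.Modules.pullbackComp q r).inv.app L).app (((ρ.autHom g ≫ q) ≫ r) ⁻¹ᵁ V)
        (((Scheme.Modules.pullbackCongr H).hom.app L).app (((ρ.autHom g ≫ q) ≫ r) ⁻¹ᵁ V)
          (((Scheme.Modules.pullbackComp (ρ.autHom g ≫ q) r).hom.app L).app ((ρ.autHom g ≫ q) ⁻¹ᵁ (r ⁻¹ᵁ V))
            (unitSection (ρ.autHom g ≫ q) ((Scheme.Modules.pullback r).obj L) (r ⁻¹ᵁ V) (unitSection r L V m)))))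
  -- left-hand side
  rw [a1, a2, a3, unitSection_map, Scheme.Modules.Hom.app_map_apply, a5]
  -- right-hand side
  rw [b1, b2, Scheme.Modules.Hom.app_map_apply, b3]
  erw [Scheme.Modules.Hom.app_map_apply (squareIso hsq L).hom (eqToHom e₂ : ((ρ.autHom g ≫ q) ≫ r) ⁻¹ᵁ V ⟶ (q ≫ r) ⁻¹ᵁ V)
    (unitSection q ((Scheme.Modules.pullback r).obj L) (r ⁻¹ᵁ V) (unitSection r L V m))]
  rw [a3']
  -- both sides are `η_p(η_{q₂}(m))` transported to the same open
  rw [presheaf_map_map_congr _ _ _ (eqToHom hk)]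
  exact (presheaf_map_map_congr _ (eqToHom e₁) (eqToHom e₂ : ((ρ.autHom g ≫ q) ≫ r) ⁻¹ᵁ V ⟶ q ⁻¹ᵁ (r ⁻¹ᵁ V))
    (eqToHom hk : ((ρ.autHom g ≫ q) ≫ r) ⁻¹ᵁ V ⟶ p ⁻¹ᵁ (q₂ ⁻¹ᵁ V)) _).symm

/-- **THE COFACES OF AN INVARIANT SECTION AGREE** (element form of `squareIso_coface_coherence`, every component read at `⊤`, the automorphism
respelled `σ_g = σ`): for a global section `s` of `r^* L`, if `g` FIXES the first coface `q^* s` read in `p^* q₂^* L` (canonical action ★ `actSections`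
of ★ `ofPullback ρ (q₂^* L)`), then the two cofaces `q^* s` and `(σ ≫ q)^* s`, read in `(q ≫ r)^* L`, are EQUAL — the shape of the hypothesis `hcof` of ★
`Morphisms/TrivialisationFpqcDescent.nonempty_iso_unit_of_cofaceFst_eq_cofaceSnd`. [cite: MumfordAV1970, §12 Thm. 1 (p. 112)] [cite: MumfordAV1970, §7 Prop. 2 (p. 70)] -/
theorem coface_eq_of_actSections_eq_self (σ : Z ⟶ Z) (hσ : ρ.autHom g = σ) (H : (σ ≫ q) ≫ r = q ≫ r)
    (s : Γ((Scheme.Modules.pullback r).obj L, ⊤))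
    (hinv : ρ.actSections _ (ActionOver.EquivariantStructure.ofPullback ρ ((Scheme.Modules.pullback q₂).obj L)).iso g ⊤
        ((squareIso hsq L).hom.app ⊤ (unitSection q ((Scheme.Modules.pullback r).obj L) ⊤ s)) =
      (squareIso hsq L).hom.app ⊤ (unitSection q ((Scheme.Modules.pullback r).obj L) ⊤ s)) :
    ((Scheme.Modules.pullbackComp q r).hom.app L).app ⊤ (unitSection q ((Scheme.Modules.pullback r).obj L) ⊤ s) =
      ((Scheme.Modules.pullbackCongr H).hom.app L).app ⊤
        (((Scheme.Modules.pullbackComp (σ ≫ q) r).hom.app L).app ⊤ (unitSection (σ ≫ q) ((Scheme.Modules.pullback r).obj L) ⊤ s)) := by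
  subst hσ
  -- the coherence identity evaluated at `η_{σ_g ≫ q}(s)`
  have hev := congrArg (fun ψ => Scheme.Modules.Hom.app ψ ⊤ (unitSection (ρ.autHom g ≫ q) ((Scheme.Modules.pullback r).obj L) ⊤ s))
    (squareIso_coface_coherence r q q₂ hsq ρ g L H)
  simp only [Scheme.Modules.Hom.comp_app, CategoryTheory.comp_apply] at hev
  -- its left-hand side is `φ_g(η_{σ_g}(y))`, `y :=` the first coface read in `p^* q₂^* L`
  have a1 : ((Scheme.Modules.pullbackComp (ρ.autHom g) q).inv.app ((Scheme.Modules.pullback r).obj L)).app ⊤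
        (unitSection (ρ.autHom g ≫ q) ((Scheme.Modules.pullback r).obj L) ⊤ s) =
      unitSection (ρ.autHom g) ((Scheme.Modules.pullback q).obj ((Scheme.Modules.pullback r).obj L)) (q ⁻¹ᵁ ⊤)
        (unitSection q ((Scheme.Modules.pullback r).obj L) ⊤ s) :=
    pullbackComp_inv_app_unitSection' (ρ.autHom g) q ((Scheme.Modules.pullback r).obj L) ⊤ s
  have a2 : ((Scheme.Modules.pullback (ρ.autHom g)).map (squareIso hsq L).hom).app ⊤
        (unitSection (ρ.autHom g) ((Scheme.Modules.pullback q).obj ((Scheme.Modules.pullback r).obj L)) (q ⁻¹ᵁ ⊤)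
          (unitSection q ((Scheme.Modules.pullback r).obj L) ⊤ s)) =
      unitSection (ρ.autHom g) _ (q ⁻¹ᵁ ⊤)
        ((squareIso hsq L).hom.app ⊤ (unitSection q ((Scheme.Modules.pullback r).obj L) ⊤ s)) :=
    pullback_map_app_unitSection (ρ.autHom g) (squareIso hsq L).hom (q ⁻¹ᵁ ⊤) (unitSection q ((Scheme.Modules.pullback r).obj L) ⊤ s)
  have a12 := (congrArg (fun z => ((Scheme.Modules.pullback (ρ.autHom g)).map (squareIso hsq L).hom).app ⊤ z) a1).trans a2
  have hev2 := (congrArg (fun z =>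
    ((ActionOver.EquivariantStructure.ofPullback ρ ((Scheme.Modules.pullback q₂).obj L)).iso g).hom.app ⊤ z) a12).symm.trans hev
  -- `y` is fixed by `g`: the left-hand side is `y` transported along `σ_g⁻¹ p⁻¹ ⊤ = p⁻¹ ⊤`, i.e. `y`
  have hy := ActionOver.iso_hom_app_unitSection_of_actSections_eq_self ρ
    (ActionOver.EquivariantStructure.ofPullback ρ ((Scheme.Modules.pullback q₂).obj L)).iso g ⊤ _ hinv
  have hself : ((Scheme.Modules.pullback p).obj ((Scheme.Modules.pullback q₂).obj L)).presheaf.map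
      (eqToHom (ρ.preimage_preimage g ⊤)).op ((squareIso hsq L).hom.app ⊤ (unitSection q ((Scheme.Modules.pullback r).obj L) ⊤ s)) =
      (squareIso hsq L).hom.app ⊤ (unitSection q ((Scheme.Modules.pullback r).obj L) ⊤ s) :=
    presheaf_map_self _ (eqToHom (ρ.preimage_preimage g ⊤) : (⊤ : Z.Opens) ⟶ ⊤) _
  have key := hself.symm.trans (hy.symm.trans hev2)
  -- the first coface, read the same way, is `y` as well
  have b0 : ((Scheme.Modules.pullbackComp q r).inv.app L).app ⊤
      (((Scheme.Modules.pullbackComp q r).hom.app L).app ⊤ (unitSection q ((Scheme.Modules.pullback r).obj L) ⊤ s)) =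
      unitSection q ((Scheme.Modules.pullback r).obj L) ⊤ s := by
    rw [← CategoryTheory.comp_apply, ← Scheme.Modules.Hom.comp_app, ← NatTrans.comp_app, Iso.hom_inv_id, NatTrans.id_app,
      Scheme.Modules.Hom.id_app]
    rfl
  have lhs := congrArg (fun z => (squareIso hsq L).hom.app ⊤ z) b0
  -- the components of an isomorphism of modules are injective
  have hinj : ∀ {E F : Z.Modules} (γ : E ≅ F) (a b : Γ(E, ⊤)), γ.hom.app ⊤ a = γ.hom.app ⊤ b → a = b := by
    intro E F γ a b hab
    have ha : γ.inv.app ⊤ (γ.hom.app ⊤ a) = a := by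
      rw [← CategoryTheory.comp_apply, ← Scheme.Modules.Hom.comp_app, Iso.hom_inv_id, Scheme.Modules.Hom.id_app]; rfl
    have hb : γ.inv.app ⊤ (γ.hom.app ⊤ b) = b := by
      rw [← CategoryTheory.comp_apply, ← Scheme.Modules.Hom.comp_app, Iso.hom_inv_id, Scheme.Modules.Hom.id_app]; rfl
    rw [← ha, ← hb, hab]
  exact hinj ((Scheme.Modules.pullbackComp q r).app L).symm _ _ (hinj (squareIso hsq L) _ _ (lhs.trans key))

end Square

end Literature.AlgebraicGeometry.RelativeSpec

end
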